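import Summits.BirchSwinnertonDyer.BirchSwinnertonDyer.Theorems.KolyvaginRoadThreeZhangFrameHLNonsplitOfSchneider
import Summits.BirchSwinnertonDyer.BirchSwinnertonDyer.Theorems.ClassRecordThreeRegCertRows03
import Summits.BirchSwinnertonDyer.BirchSwinnertonDyer.Theorems.ClassRecordThreeRegCertRows12
import Summits.BirchSwinnertonDyer.BirchSwinnertonDyer.Theorems.ClassRecordThreeRegCertRows04
import Summits.BirchSwinnertonDyer.BirchSwinnertonDyer.Theorems.ClassRecordThreeRegCertRows63
import HarnessLib

/-!
# Route `KolyvaginRoadThree`, crux `ZhangSharpFrameAtThreeHL` (item stmt-BirchSwinnertonDyer-19574): Kolyvagin's conjecture mod 3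
# at EVERY Hoffstein–Luo frame of five named NON-SPLIT A1 curves of koly's KOLY-WITNESS table, modulo the published inputs ONLY
# — the REG3CERT kernel rows fed to `Koly.kolyvaginClass_one_ne_zero_allHLFrames_of_regulatorRung`
# (cell `bsd-stepL`, seat `bsd-stepL-koly3b` (PART 1b ACCEL seat (10)); `--supports stmt-BirchSwinnertonDyer-19574`, helper)

HONEST FRAMING. BSD is not proved by any of this; each theorem is about ONE curve and closes nothing; Kolyvagin's conjecture
mod 3 (the crux) and Schneider's conjecture are asserted nowhere class-wide; the published inputs are named facts taken as
binders. THEOREMS ONLY (0 definitions, 0 named facts, 0 `sorry`). PARTITION: O2@3 (B10) × 5 of the 646 TRUE-OPEN non-split A1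
classes — types-the-object-of; closes: none.

WHAT. `KolyvaginRoadThreeZhangFrameHLNonsplitOfSchneider.lean` (this seat, p456367) proved: for a globally minimal `W` and a
REG3CERT-shaped rung `ClassX11b W 3 → Ram W 3 → ¬ split(3) → ClassClosure.RegulatorNonvanishingAt W 3`, the fourteen published
inputs (Gross–Zagier, Kolyvagin, Skinner 2016 Thms A∕C, GZK, modularity, Shimura reciprocity at conductor 1, Gross 1991 §3 ×2,
McCallum 1991 Cor. 5.6 (divisibility half), Stein–Wuthrich 2013 Thm 6.1 + §4.2, Disegni 2020 Thm 1, modular parametrisations)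
give the conclusion of the crux at EVERY Hoffstein–Luo frame of `W`. reg3-eng's REG3CERT programme (crux `SchneiderAtThree`,
item 19106) landed 703 such rungs as KERNEL theorems (`RegMult.Rows.rung_<label>`: the cyclotomic 3-adic height of an explicit
admissible point, checked in the kernel), 626 of them on A1 curves (seat census, HOME/HANDOFF § koly3b). This file instantiates
the five TRUE-OPEN non-split rows of koly's `KOLY-WITNESS.md` v5 that have a kernel row (the sixth, 347253a1 = the BC5 rung, is
`Koly.Rung347253a1.rung_347253a1_of_published`; 487713b1 has no kernel row yet): two independent instruments — koly's PARI
Kolyvagin certificates (derived Heegner points, evidence on 19574) and the kernel 3-adic regulator rows — now bear on the same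
curves, and for 460023a1 (the S-A row where the level-`2` class was certified ZERO) the existence of SOME non-zero class on every
HL frame follows modulo print, as MEMO-v7's parity law predicts (witness at an even level), without computing it.

One theorem per curve: `kolyvaginModThree_allHLFrames_<label>` — the registered `stub_zhangFrameHL_nonsplit` signature with `W`
fixed to the curve, from the fourteen published binders alone. [cite: SteinWuthrich2013, §4.2 (p. 15)]
[cite: Skinner2016PacificMC, Thm. A (§1)] [cite: Disegni2020, Thm. 1] [cite: McCallumLMS1991, §5 Cor. 5.6]
[cite: WZhang2014, Remark 5 and Thm. 10.2]
-/

noncomputable section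

open scoped Classical

namespace Summit.BirchSwinnertonDyer.Rank1Residual.X11b.Three.Koly.NonsplitRows

open WeierstrassCurve NumberField Literature.NumberTheory.EllipticCurves
  Literature.NumberTheory.EllipticCurves.ModularForms
  Literature.NumberTheory.EllipticCurves.Rank1Residual
  Literature.NumberTheory.EllipticCurves.Skinner2016
  Literature.NumberTheory.EllipticCurves.SteinWuthrich2013
  Literature.NumberTheory.EllipticCurves.Disegni2020
  Summit.BirchSwinnertonDyer.Rank1Residual Summit.BirchSwinnertonDyer.Rank1Residual.X11b

/-- **Kolyvagin's conjecture mod 3 on every Hoffstein–Luo frame of Cremona `212565e1` = `⟨0, -1, 1, -2816681, -1818572113⟩` (non-split A1 row), modulo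
the fourteen published inputs ONLY** — the registered `stub_zhangFrameHL_nonsplit` signature with `W` fixed: Schneider at
`(212565e1, 3)` is the KERNEL row `RegMult.Rows.rung_212565e1` (REG3CERT batch 03), fed to
`Koly.kolyvaginClass_one_ne_zero_allHLFrames_of_regulatorRung`. Record: x11b3 E-K6 row; koly kit j250734: recognition of the level-2 derived point FAILED (no verdict) — settled here modulo print. One curve; CONDITIONAL on the published
binders; nothing is booked. [cite: SteinWuthrich2013, §4.2] [cite: Skinner2016PacificMC, Thm. A (§1)] [cite: McCallumLMS1991, §5 Cor. 5.6] -/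
theorem kolyvaginModThree_allHLFrames_212565e1 (W : WeierstrassCurve ℚ) (hW : W = ⟨0, -1, 1, -2816681, -1818572113⟩)
    [W.IsElliptic] [W.IsGloballyMinimal] [NeZero (W.conductorNorm ℤ)]
    (hGZ : ∀ (K : Type) [Field K] [NumberField K], gross_zagier (W.conductorNorm ℤ) W K)
    (hKo : ∀ (K : Type) [Field K] [NumberField K], kolyvagin (W.conductorNorm ℤ) W K)
    (hSk : thmC_padicValRat_bsd_rank_zero)
    (hGZK : rank_eq_analyticRank_of_analyticRank_le_one) (hmod : hasEntireLFunction_rat)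
    (hrec : ∀ (K : Type) [Field K] [NumberField K], heegnerPointOfConductor_one_galoisConj (W.conductorNorm ℤ) W K)
    (h1 : ∀ (K : Type) [Field K] [NumberField K],
      phi_heegnerPointOfConductor_mem_range_map_ringClassField (W.conductorNorm ℤ) W K)
    (h2 : ∀ (K : Type) [Field K] [NumberField K], exists_generator_ringClassGalOver K)
    (hMcU : McCallum1991_padicValNat_card_sha_primary_add_le_of_globalDivisibility)
    (hSkA : thmA_charIdeal_multiplicative) (hJn : thm61_nonsplitMultiplicative) (hHn : exists_isMultCanonical)
    (hD : thm1_padicBSD_rankOne_multiplicative) (hpar : nonempty_modularParametrizationData) :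
    ∀ (K : Type) [Field K] [NumberField K] (Dt : ModularParametrizationData W (W.conductorNorm ℤ)) (β : ℤ)
      (ι : K →+* ℂ), ClassX11b W 3 → W.HasMultiplicativeReductionAtPrime 3 →
      ¬ W.HasSplitMultiplicativeReductionAtPrime 3 → Surj W 3 → Ram W 3 → ¬ 3 ∣ W.tamagawaProduct →
      IsImaginaryQuadratic K → Odd (NumberField.discr K) → SatisfiesHeegnerHypothesis (W.conductorNorm ℤ) K →
      (W.quadraticTwist (NumberField.discr K : ℚ)).entireLFunction 1 ≠ 0 → NumberField.discr K ≠ -3 →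
      (4 * (W.conductorNorm ℤ : ℤ)) ∣ β ^ 2 - NumberField.discr K → ¬ (3 : ℤ) ∣ Dt.c →
      ∃ (n : ℕ) (d : KolyvaginHeegnerData Dt β ι n),
        KolyvaginDescent.KolSupp (Zhang2014.IsKolyvaginPrime (W.conductorNorm ℤ) W K 3) n ∧
          d.kolyvaginClass Nat.prime_three 1 ≠ 0 :=
  kolyvaginClass_one_ne_zero_allHLFrames_of_regulatorRung W hGZ hKo hSk hGZK hmod hrec h1 h2 hMcU hSkA hJn hHn hD hpar
    (RegMult.Rows.rung_212565e1 hGZK W hW)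

/-- **Kolyvagin's conjecture mod 3 on every Hoffstein–Luo frame of Cremona `320235g1` = `⟨0, -1, 1, -4786, 129051⟩` (non-split A1 row), modulo
the fourteen published inputs ONLY** — the registered `stub_zhangFrameHL_nonsplit` signature with `W` fixed: Schneider at
`(320235g1, 3)` is the KERNEL row `RegMult.Rows.rung_320235g1` (REG3CERT batch 08), fed to
`Koly.kolyvaginClass_one_ne_zero_allHLFrames_of_regulatorRung`. Record: KOLY-WITNESS v5: a certified non-zero derived class (kit) — two instruments agree. One curve; CONDITIONAL on the published
binders; nothing is booked. [cite: SteinWuthrich2013, §4.2] [cite: Skinner2016PacificMC, Thm. A (§1)] [cite: McCallumLMS1991, §5 Cor. 5.6] -/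
theorem kolyvaginModThree_allHLFrames_320235g1 (W : WeierstrassCurve ℚ) (hW : W = ⟨0, -1, 1, -4786, 129051⟩)
    [W.IsElliptic] [W.IsGloballyMinimal] [NeZero (W.conductorNorm ℤ)]
    (hGZ : ∀ (K : Type) [Field K] [NumberField K], gross_zagier (W.conductorNorm ℤ) W K)
    (hKo : ∀ (K : Type) [Field K] [NumberField K], kolyvagin (W.conductorNorm ℤ) W K)
    (hSk : thmC_padicValRat_bsd_rank_zero)
    (hGZK : rank_eq_analyticRank_of_analyticRank_le_one) (hmod : hasEntireLFunction_rat)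
    (hrec : ∀ (K : Type) [Field K] [NumberField K], heegnerPointOfConductor_one_galoisConj (W.conductorNorm ℤ) W K)
    (h1 : ∀ (K : Type) [Field K] [NumberField K],
      phi_heegnerPointOfConductor_mem_range_map_ringClassField (W.conductorNorm ℤ) W K)
    (h2 : ∀ (K : Type) [Field K] [NumberField K], exists_generator_ringClassGalOver K)
    (hMcU : McCallum1991_padicValNat_card_sha_primary_add_le_of_globalDivisibility)
    (hSkA : thmA_charIdeal_multiplicative) (hJn : thm61_nonsplitMultiplicative) (hHn : exists_isMultCanonical)
    (hD : thm1_padicBSD_rankOne_multiplicative) (hpar : nonempty_modularParametrizationData) :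
    ∀ (K : Type) [Field K] [NumberField K] (Dt : ModularParametrizationData W (W.conductorNorm ℤ)) (β : ℤ)
      (ι : K →+* ℂ), ClassX11b W 3 → W.HasMultiplicativeReductionAtPrime 3 →
      ¬ W.HasSplitMultiplicativeReductionAtPrime 3 → Surj W 3 → Ram W 3 → ¬ 3 ∣ W.tamagawaProduct →
      IsImaginaryQuadratic K → Odd (NumberField.discr K) → SatisfiesHeegnerHypothesis (W.conductorNorm ℤ) K →
      (W.quadraticTwist (NumberField.discr K : ℚ)).entireLFunction 1 ≠ 0 → NumberField.discr K ≠ -3 →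
      (4 * (W.conductorNorm ℤ : ℤ)) ∣ β ^ 2 - NumberField.discr K → ¬ (3 : ℤ) ∣ Dt.c →
      ∃ (n : ℕ) (d : KolyvaginHeegnerData Dt β ι n),
        KolyvaginDescent.KolSupp (Zhang2014.IsKolyvaginPrime (W.conductorNorm ℤ) W K 3) n ∧
          d.kolyvaginClass Nat.prime_three 1 ≠ 0 :=
  kolyvaginClass_one_ne_zero_allHLFrames_of_regulatorRung W hGZ hKo hSk hGZK hmod hrec h1 h2 hMcU hSkA hJn hHn hD hpar
    (RegMult.Rows.rung_320235g1 hGZK W hW)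

/-- **Kolyvagin's conjecture mod 3 on every Hoffstein–Luo frame of Cremona `398325k1` = `⟨0, -1, 1, -2778783, 20173636343⟩` (non-split A1 row), modulo
the fourteen published inputs ONLY** — the registered `stub_zhangFrameHL_nonsplit` signature with `W` fixed: Schneider at
`(398325k1, 3)` is the KERNEL row `RegMult.Rows.rung_398325k1` (REG3CERT batch 12), fed to
`Koly.kolyvaginClass_one_ne_zero_allHLFrames_of_regulatorRung`. Record: KOLY-WITNESS v5 row — two instruments agree. One curve; CONDITIONAL on the published
binders; nothing is booked. [cite: SteinWuthrich2013, §4.2] [cite: Skinner2016PacificMC, Thm. A (§1)] [cite: McCallumLMS1991, §5 Cor. 5.6] -/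
theorem kolyvaginModThree_allHLFrames_398325k1 (W : WeierstrassCurve ℚ) (hW : W = ⟨0, -1, 1, -2778783, 20173636343⟩)
    [W.IsElliptic] [W.IsGloballyMinimal] [NeZero (W.conductorNorm ℤ)]
    (hGZ : ∀ (K : Type) [Field K] [NumberField K], gross_zagier (W.conductorNorm ℤ) W K)
    (hKo : ∀ (K : Type) [Field K] [NumberField K], kolyvagin (W.conductorNorm ℤ) W K)
    (hSk : thmC_padicValRat_bsd_rank_zero)
    (hGZK : rank_eq_analyticRank_of_analyticRank_le_one) (hmod : hasEntireLFunction_rat)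
    (hrec : ∀ (K : Type) [Field K] [NumberField K], heegnerPointOfConductor_one_galoisConj (W.conductorNorm ℤ) W K)
    (h1 : ∀ (K : Type) [Field K] [NumberField K],
      phi_heegnerPointOfConductor_mem_range_map_ringClassField (W.conductorNorm ℤ) W K)
    (h2 : ∀ (K : Type) [Field K] [NumberField K], exists_generator_ringClassGalOver K)
    (hMcU : McCallum1991_padicValNat_card_sha_primary_add_le_of_globalDivisibility)
    (hSkA : thmA_charIdeal_multiplicative) (hJn : thm61_nonsplitMultiplicative) (hHn : exists_isMultCanonical)
    (hD : thm1_padicBSD_rankOne_multiplicative) (hpar : nonempty_modularParametrizationData) :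
    ∀ (K : Type) [Field K] [NumberField K] (Dt : ModularParametrizationData W (W.conductorNorm ℤ)) (β : ℤ)
      (ι : K →+* ℂ), ClassX11b W 3 → W.HasMultiplicativeReductionAtPrime 3 →
      ¬ W.HasSplitMultiplicativeReductionAtPrime 3 → Surj W 3 → Ram W 3 → ¬ 3 ∣ W.tamagawaProduct →
      IsImaginaryQuadratic K → Odd (NumberField.discr K) → SatisfiesHeegnerHypothesis (W.conductorNorm ℤ) K →
      (W.quadraticTwist (NumberField.discr K : ℚ)).entireLFunction 1 ≠ 0 → NumberField.discr K ≠ -3 →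
      (4 * (W.conductorNorm ℤ : ℤ)) ∣ β ^ 2 - NumberField.discr K → ¬ (3 : ℤ) ∣ Dt.c →
      ∃ (n : ℕ) (d : KolyvaginHeegnerData Dt β ι n),
        KolyvaginDescent.KolSupp (Zhang2014.IsKolyvaginPrime (W.conductorNorm ℤ) W K 3) n ∧
          d.kolyvaginClass Nat.prime_three 1 ≠ 0 :=
  kolyvaginClass_one_ne_zero_allHLFrames_of_regulatorRung W hGZ hKo hSk hGZK hmod hrec h1 h2 hMcU hSkA hJn hHn hD hpar
    (RegMult.Rows.rung_398325k1 hGZK W hW)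

/-- **Kolyvagin's conjecture mod 3 on every Hoffstein–Luo frame of Cremona `460023a1` = `⟨0, -1, 1, -47029, -4352043⟩` (non-split A1 row), modulo
the fourteen published inputs ONLY** — the registered `stub_zhangFrameHL_nonsplit` signature with `W` fixed: Schneider at
`(460023a1, 3)` is the KERNEL row `RegMult.Rows.rung_460023a1` (REG3CERT batch 04), fed to
`Koly.kolyvaginClass_one_ne_zero_allHLFrames_of_regulatorRung`. Record: the S-A row (#Ш(E)_an = 9): koly kit j250734 certified c₁(2) = 0 at ℚ(√−11), ℓ = 2 (MEMO-v7: on S-A rows the least witnessing level is a product of an EVEN number of Kolyvagin primes); here: SOME non-zero c₁(n) EXISTS on every HL frame, modulo print — existence without a computed witness, consistent with the parity law. One curve; CONDITIONAL on the published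
binders; nothing is booked. [cite: SteinWuthrich2013, §4.2] [cite: Skinner2016PacificMC, Thm. A (§1)] [cite: McCallumLMS1991, §5 Cor. 5.6] -/
theorem kolyvaginModThree_allHLFrames_460023a1 (W : WeierstrassCurve ℚ) (hW : W = ⟨0, -1, 1, -47029, -4352043⟩)
    [W.IsElliptic] [W.IsGloballyMinimal] [NeZero (W.conductorNorm ℤ)]
    (hGZ : ∀ (K : Type) [Field K] [NumberField K], gross_zagier (W.conductorNorm ℤ) W K)
    (hKo : ∀ (K : Type) [Field K] [NumberField K], kolyvagin (W.conductorNorm ℤ) W K)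
    (hSk : thmC_padicValRat_bsd_rank_zero)
    (hGZK : rank_eq_analyticRank_of_analyticRank_le_one) (hmod : hasEntireLFunction_rat)
    (hrec : ∀ (K : Type) [Field K] [NumberField K], heegnerPointOfConductor_one_galoisConj (W.conductorNorm ℤ) W K)
    (h1 : ∀ (K : Type) [Field K] [NumberField K],
      phi_heegnerPointOfConductor_mem_range_map_ringClassField (W.conductorNorm ℤ) W K)
    (h2 : ∀ (K : Type) [Field K] [NumberField K], exists_generator_ringClassGalOver K)
    (hMcU : McCallum1991_padicValNat_card_sha_primary_add_le_of_globalDivisibility)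
    (hSkA : thmA_charIdeal_multiplicative) (hJn : thm61_nonsplitMultiplicative) (hHn : exists_isMultCanonical)
    (hD : thm1_padicBSD_rankOne_multiplicative) (hpar : nonempty_modularParametrizationData) :
    ∀ (K : Type) [Field K] [NumberField K] (Dt : ModularParametrizationData W (W.conductorNorm ℤ)) (β : ℤ)
      (ι : K →+* ℂ), ClassX11b W 3 → W.HasMultiplicativeReductionAtPrime 3 →
      ¬ W.HasSplitMultiplicativeReductionAtPrime 3 → Surj W 3 → Ram W 3 → ¬ 3 ∣ W.tamagawaProduct →
      IsImaginaryQuadratic K → Odd (NumberField.discr K) → SatisfiesHeegnerHypothesis (W.conductorNorm ℤ) K →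
      (W.quadraticTwist (NumberField.discr K : ℚ)).entireLFunction 1 ≠ 0 → NumberField.discr K ≠ -3 →
      (4 * (W.conductorNorm ℤ : ℤ)) ∣ β ^ 2 - NumberField.discr K → ¬ (3 : ℤ) ∣ Dt.c →
      ∃ (n : ℕ) (d : KolyvaginHeegnerData Dt β ι n),
        KolyvaginDescent.KolSupp (Zhang2014.IsKolyvaginPrime (W.conductorNorm ℤ) W K 3) n ∧
          d.kolyvaginClass Nat.prime_three 1 ≠ 0 :=
  kolyvaginClass_one_ne_zero_allHLFrames_of_regulatorRung W hGZ hKo hSk hGZK hmod hrec h1 h2 hMcU hSkA hJn hHn hD hpar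
    (RegMult.Rows.rung_460023a1 hGZK W hW)

/-- **Kolyvagin's conjecture mod 3 on every Hoffstein–Luo frame of Cremona `471417f1` = `⟨0, -1, 1, 1606, -123193⟩` (non-split A1 row), modulo
the fourteen published inputs ONLY** — the registered `stub_zhangFrameHL_nonsplit` signature with `W` fixed: Schneider at
`(471417f1, 3)` is the KERNEL row `RegMult.Rows.rung_471417f1` (REG3CERT batch 63), fed to
`Koly.kolyvaginClass_one_ne_zero_allHLFrames_of_regulatorRung`. Record: KOLY-WITNESS v5 row — two instruments agree. One curve; CONDITIONAL on the published
binders; nothing is booked. [cite: SteinWuthrich2013, §4.2] [cite: Skinner2016PacificMC, Thm. A (§1)] [cite: McCallumLMS1991, §5 Cor. 5.6] -/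
theorem kolyvaginModThree_allHLFrames_471417f1 (W : WeierstrassCurve ℚ) (hW : W = ⟨0, -1, 1, 1606, -123193⟩)
    [W.IsElliptic] [W.IsGloballyMinimal] [NeZero (W.conductorNorm ℤ)]
    (hGZ : ∀ (K : Type) [Field K] [NumberField K], gross_zagier (W.conductorNorm ℤ) W K)
    (hKo : ∀ (K : Type) [Field K] [NumberField K], kolyvagin (W.conductorNorm ℤ) W K)
    (hSk : thmC_padicValRat_bsd_rank_zero)
    (hGZK : rank_eq_analyticRank_of_analyticRank_le_one) (hmod : hasEntireLFunction_rat)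
    (hrec : ∀ (K : Type) [Field K] [NumberField K], heegnerPointOfConductor_one_galoisConj (W.conductorNorm ℤ) W K)
    (h1 : ∀ (K : Type) [Field K] [NumberField K],
      phi_heegnerPointOfConductor_mem_range_map_ringClassField (W.conductorNorm ℤ) W K)
    (h2 : ∀ (K : Type) [Field K] [NumberField K], exists_generator_ringClassGalOver K)
    (hMcU : McCallum1991_padicValNat_card_sha_primary_add_le_of_globalDivisibility)
    (hSkA : thmA_charIdeal_multiplicative) (hJn : thm61_nonsplitMultiplicative) (hHn : exists_isMultCanonical)
    (hD : thm1_padicBSD_rankOne_multiplicative) (hpar : nonempty_modularParametrizationData) :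
    ∀ (K : Type) [Field K] [NumberField K] (Dt : ModularParametrizationData W (W.conductorNorm ℤ)) (β : ℤ)
      (ι : K →+* ℂ), ClassX11b W 3 → W.HasMultiplicativeReductionAtPrime 3 →
      ¬ W.HasSplitMultiplicativeReductionAtPrime 3 → Surj W 3 → Ram W 3 → ¬ 3 ∣ W.tamagawaProduct →
      IsImaginaryQuadratic K → Odd (NumberField.discr K) → SatisfiesHeegnerHypothesis (W.conductorNorm ℤ) K →
      (W.quadraticTwist (NumberField.discr K : ℚ)).entireLFunction 1 ≠ 0 → NumberField.discr K ≠ -3 →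
      (4 * (W.conductorNorm ℤ : ℤ)) ∣ β ^ 2 - NumberField.discr K → ¬ (3 : ℤ) ∣ Dt.c →
      ∃ (n : ℕ) (d : KolyvaginHeegnerData Dt β ι n),
        KolyvaginDescent.KolSupp (Zhang2014.IsKolyvaginPrime (W.conductorNorm ℤ) W K 3) n ∧
          d.kolyvaginClass Nat.prime_three 1 ≠ 0 :=
  kolyvaginClass_one_ne_zero_allHLFrames_of_regulatorRung W hGZ hKo hSk hGZK hmod hrec h1 h2 hMcU hSkA hJn hHn hD hpar
    (RegMult.Rows.rung_471417f1 hGZK W hW)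

end Summit.BirchSwinnertonDyer.Rank1Residual.X11b.Three.Koly.NonsplitRows

end
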